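import Mathlib
import Literature.AlgebraicGeometry.Resolution.PlaneGermBlowup
import Literature.AlgebraicGeometry.Resolution.WeightedShear
import Literature.AlgebraicGeometry.Resolution.PlaneGermBlowupCalculus

/-!
# `WeightedInvariant.LocalWeightedDrop`, line `hasse-ridge-face-selection`: the successor toolkit

Crux item stmt-ResolutionOfSingularities-8899 (route `ResolutionOfSingularities/WeightedInvariant`),
skeleton v12 of the line `hasse-ridge-face-selection`, stub `stub_blowupSuccessorToolkit`, PROVED here
(statement verbatim from the ledger registration).

**Statement (folklore calculus of the first neighbourhood of a plane curve germ, any field `k`).**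
For `b ∈ k[[x, y]]` (`x = X 0`, `y = X 1`) and the two charts of the point blow-up
`PlaneGerm.dirChart t = (x, x (t + y))`, `PlaneGerm.vertChart = (x y, x)`:
(1) EXISTENCE of the reduced total transform germ `D` (`PlaneGerm.IsTransform`: `b∘chart = x^{ord b} · st`,
`D = x · st`) in both charts; (2) UNIQUENESS of `D` given the chart, and `D ≠ 0` for every successor;
(3) FINITE BRANCHING: for all but finitely many slopes `t` every transform germ has normal-crossing
support (`PlaneGerm.IsNC`); (4) transforms of a multiple `d` of `b` are multiples of the transform of `b`;
(5) a divisor of a germ with normal-crossing support has normal-crossing support.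

**Proof.**  (1) `x ∣ chart i` for both charts, so the image of a monomial of degree `≥ m` is divisible
by `x^m`; with `MvPowerSeries.coeff_subst` and `MvPowerSeries.X_pow_dvd_iff`, `x^{ord b} ∣ b∘chart`.
(2) `ord b` determines `m`, and `x^m` is cancellable; `D ≠ 0` because both charts are injective:
`vertChart` sends the monomial `(p, q)` to the monomial `(p + q, p)`, and `dirChart t` is the shear
`(x, y + t x)` (a formal coordinate change, injective by `FormalCoordChange.subst_ne_zero_of_isUnit_det`)
followed by `(x, x y)`, which sends `(p, q)` to `(p + q, q)`.  (3) The constant term of the strict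
transform `st` at slope `t` is `P(t)`, `P = ∑_{j ≤ m} b_{(m - j, j)} Y^j ≠ 0` (computed with
`WeightedShear.coeff_subst_of_weight_le`); off the roots of `P`, `D = st · x` with `st` a unit is a normal
crossing in the identity coordinates.  (4) `subst` is multiplicative and orders add
(`MvPowerSeries.order_mul`).  (5) `x` and `y` are prime in `k[[x, y]]` (kill the variable: a ring map whose
kernel is the multiples of the variable), so by `mul_eq_mul_prime_pow` a divisor of `u · x^a · y^c`, `u` a
unit, is `u' · x^{a'} · y^{c'}` with `u'` a unit; apply this to `b∘Φ ∣ d∘Φ`.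
Clauses (1), (2), (4), (5) are assembled from
`Literature/AlgebraicGeometry/Resolution/PlaneGermBlowupCalculus.lean` (`PlaneGerm.exists_isTransform`, `isTransform_unique`, `isTransform_ne_zero`, `subst_dirChart_ne_zero`,
`subst_vertChart_ne_zero`, `exists_isTransform_mul`, `isNC_of_dvd`); clause (3) is proved here.
-/

set_option linter.dupNamespace false -- mandated namespace of this single-conjunct summit

namespace Summit.ResolutionOfSingularities.ResolutionOfSingularities.Theorems

open Literature.AlgebraicGeometry.Resolution

namespace BlowupSuccessorToolkit

open MvPowerSeries

variable {k : Type} [Field k]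

/-! ### Finite branching: the constant term of the strict transform at slope `t` -/

/-- The `x^m`-coefficient of `b(x, x(t + y))`, `m = ord b`, is `∑_{j ≤ m} b_{(m - j, j)} t^j`. -/
theorem coeff_single_subst_dirChart (t : k) {b : MvPowerSeries (Fin 2) k} {m : ℕ} (hm : b.order = m) :
    coeff (Finsupp.single 0 m) (subst (PlaneGerm.dirChart t) b) =
      ∑ j ∈ Finset.range (m + 1),
        coeff (Finsupp.single 0 (m - j) + Finsupp.single 1 j) b * t ^ j := by
  classical
  have h11 : (![1, 1] : Fin 2 → ℕ) = fun _ => 1 := by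
    funext i
    fin_cases i <;> rfl
  have hg : ((1 * m : ℕ) : ℕ∞) ≤ weightedOrder ![1, 1] b := by
    rw [h11, one_mul]
    show (m : ℕ∞) ≤ b.order
    exact hm.symm.le
  have h0 : (1 : ℕ∞) ≤ weightedOrder ![1, 1] (PlaneGerm.dirChart t 0) :=
    WeightedShear.one_le_weightedOrder_X_zero 1
  have h1 : ((1 : ℕ) : ℕ∞) ≤ weightedOrder ![1, 1] (PlaneGerm.dirChart t 1) := by
    apply nat_le_weightedOrder
    intro e he
    rw [WeightedShear.weight_fin_two] at he
    have he0 : e = 0 := by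
      ext i
      fin_cases i
      · show e 0 = 0
        omega
      · show e 1 = 0
        omega
    rw [he0, coeff_zero_eq_constantCoeff_apply]
    exact PlaneGerm.constantCoeff_dirChart t 1
  rw [WeightedShear.coeff_subst_of_weight_le le_rfl (PlaneGerm.constantCoeff_dirChart t) h0 h1 hg
    (e := Finsupp.single 0 m) (by simp), map_sum]
  refine Finset.sum_congr rfl fun j hj => ?_
  have hj' : j ≤ m := Nat.lt_succ_iff.mp (Finset.mem_range.mp hj)
  rw [map_smul, smul_eq_mul, one_mul]
  congr 1
  rw [PlaneGerm.dirChart_zero, PlaneGerm.dirChart_one, mul_pow, ← mul_assoc, ← pow_add,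
    Nat.sub_add_cancel hj', X_pow_eq, coeff_monomial_mul, if_pos le_rfl, tsub_self, one_mul,
    coeff_zero_eq_constantCoeff_apply, map_pow, map_add, constantCoeff_C, constantCoeff_X, add_zero]

/-- The tangent polynomial `P = ∑_{j ≤ m} b_{(m - j, j)} Y^j` of a germ of order `m` is non-zero. -/
theorem tangentPoly_ne_zero {b : MvPowerSeries (Fin 2) k} {m : ℕ} (hm : b.order = m) :
    (∑ j ∈ Finset.range (m + 1), Polynomial.C (coeff (Finsupp.single 0 (m - j) + Finsupp.single 1 j) b) *
      Polynomial.X ^ j : Polynomial k) ≠ 0 := by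
  classical
  obtain ⟨⟨d, hd, hdeg⟩, -⟩ := order_eq_nat.mp hm
  have hdeg' : d 0 + d 1 = m := by
    rw [Finsupp.degree_eq_sum, Fin.sum_univ_two] at hdeg
    exact hdeg
  obtain ⟨j₀, hj₀⟩ : ∃ j₀, d 1 = j₀ := ⟨_, rfl⟩
  have hj₀m : j₀ ≤ m := by omega
  have hdeq : d = Finsupp.single 0 (m - j₀) + Finsupp.single 1 j₀ := by
    ext i
    fin_cases i
    · simp
      omega
    · simp [hj₀]
  intro h0
  apply hd
  have h1 := congrArg (fun P : Polynomial k => P.coeff j₀) h0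
  simp only [Polynomial.finsetSum_coeff, Polynomial.coeff_C_mul_X_pow, Polynomial.coeff_zero] at h1
  rw [Finset.sum_eq_single j₀] at h1
  · rw [hdeq]
    simpa using h1
  · intro j _ hne
    rw [if_neg (Ne.symm hne)]
  · intro h
    exact absurd (Finset.mem_range.mpr (Nat.lt_succ_of_le hj₀m)) h

/-- `x · u` with `u` a unit has normal-crossing support (identity coordinates). -/
theorem isNC_X_mul {st : MvPowerSeries (Fin 2) k} (hst : constantCoeff st ≠ 0) :
    PlaneGerm.IsNC (X 0 * st) := by
  classical
  refine ⟨X, st, 1, 0, fun i => constantCoeff_X i, ?_, hst, ?_⟩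
  · simp [Matrix.det_fin_two, coeff_index_single_X]
  · show subst X (X 0 * st) = st * X 0 ^ 1 * X 1 ^ 0
    rw [subst_self]
    show X 0 * st = st * X 0 ^ 1 * X 1 ^ 0
    ring

/-- FINITE BRANCHING: off the roots of the tangent polynomial the transform germ is `x · unit`. -/
theorem finite_branching {b : MvPowerSeries (Fin 2) k} (hb : b ≠ 0) :
    ∃ T : Finset k, ∀ t ∉ T, ∀ D : MvPowerSeries (Fin 2) k,
      PlaneGerm.IsTransform (PlaneGerm.dirChart t) b D → PlaneGerm.IsNC D := by
  classical
  obtain ⟨m, hm⟩ : ∃ m : ℕ, b.order = m := ⟨_, (ne_zero_iff_order_finite.mp hb).symm⟩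
  obtain ⟨P, hP⟩ : ∃ P : Polynomial k, P = ∑ j ∈ Finset.range (m + 1),
      Polynomial.C (coeff (Finsupp.single 0 (m - j) + Finsupp.single 1 j) b) * Polynomial.X ^ j :=
    ⟨_, rfl⟩
  have hP0 : P ≠ 0 := hP ▸ tangentPoly_ne_zero hm
  refine ⟨P.roots.toFinset, fun t ht D hD => ?_⟩
  have heval : P.eval t ≠ 0 := by
    intro h
    apply ht
    rw [Multiset.mem_toFinset, Polynomial.mem_roots hP0]
    exact h
  obtain ⟨m', st, hm', hsub, rfl⟩ := hD
  have hmm : m' = m := by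
    rw [hm] at hm'
    exact_mod_cast hm'.symm
  subst hmm
  apply isNC_X_mul
  have hst : constantCoeff st = P.eval t := by
    have h := coeff_single_subst_dirChart t hm
    rw [hsub, X_pow_eq, coeff_monomial_mul, if_pos le_rfl, tsub_self, one_mul,
      coeff_zero_eq_constantCoeff_apply] at h
    rw [h, hP, Polynomial.eval_finsetSum]
    refine Finset.sum_congr rfl fun j _ => ?_
    simp [Polynomial.eval_mul, Polynomial.eval_pow, Polynomial.eval_C, Polynomial.eval_X]
  rwa [hst]

end BlowupSuccessorToolkit

open BlowupSuccessorToolkit in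
/-- SUCCESSOR TOOLKIT (folklore calculus of the first neighbourhood, any field).  (1) existence of the
first-neighbourhood germs `D` with `b∘chart = x^{ord b}·st`, `D = x·st`, in both charts; (2) uniqueness of `D`
given the chart, and `D ≠ 0`; (3) FINITE BRANCHING: for all but finitely many slopes `t` (the tangent
directions = roots of the initial form) the germ is `x · unit`, a normal crossing; (4) transforms of a divisor
divide (`b ∣ d ⇒ D_b ∣ D_d`, since `subst` is a ring map and orders add); (5) a divisor of a germ with
normal-crossing support has normal-crossing support (divisors of `u·xᵃ·yᶜ` in `k[[x,y]]` are of the same form: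
`x`, `y` are prime). -/
theorem stub_blowupSuccessorToolkit : ∀ (k : Type) [Field k],
    (∀ b : MvPowerSeries (Fin 2) k, b ≠ 0 →
      (∀ t : k, ∃ D, PlaneGerm.IsTransform (PlaneGerm.dirChart t) b D) ∧
      ∃ D, PlaneGerm.IsTransform (PlaneGerm.vertChart k) b D) ∧
    (∀ (Φ : Fin 2 → MvPowerSeries (Fin 2) k) (b D D' : MvPowerSeries (Fin 2) k),
      PlaneGerm.IsTransform Φ b D → PlaneGerm.IsTransform Φ b D' → D = D') ∧
    (∀ b D : MvPowerSeries (Fin 2) k, PlaneGerm.IsSuccessor b D → D ≠ 0) ∧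
    (∀ b : MvPowerSeries (Fin 2) k, b ≠ 0 → ∃ T : Finset k, ∀ t ∉ T, ∀ D : MvPowerSeries (Fin 2) k,
      PlaneGerm.IsTransform (PlaneGerm.dirChart t) b D → PlaneGerm.IsNC D) ∧
    (∀ b d D : MvPowerSeries (Fin 2) k, d ≠ 0 → b ∣ d →
      (∀ t : k, PlaneGerm.IsTransform (PlaneGerm.dirChart t) b D →
        ∃ D', PlaneGerm.IsTransform (PlaneGerm.dirChart t) d D' ∧ D ∣ D') ∧
      (PlaneGerm.IsTransform (PlaneGerm.vertChart k) b D →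
        ∃ D', PlaneGerm.IsTransform (PlaneGerm.vertChart k) d D' ∧ D ∣ D')) ∧
    (∀ b d : MvPowerSeries (Fin 2) k, d ≠ 0 → b ∣ d → PlaneGerm.IsNC d → PlaneGerm.IsNC b) := by
  intro k _
  refine ⟨fun b hb => ⟨fun t => ?_, ?_⟩, fun Φ b D D' h h' => PlaneGerm.isTransform_unique h h',
    fun b D hS => ?_, fun b hb => finite_branching hb, fun b d D hd hbd => ?_,
    fun b d _ hbd hNC => PlaneGerm.isNC_of_dvd hbd hNC⟩
  · exact PlaneGerm.exists_isTransform (PlaneGerm.hasSubst_dirChart t) (PlaneGerm.X_dvd_dirChart t) hb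
  · exact PlaneGerm.exists_isTransform PlaneGerm.hasSubst_vertChart PlaneGerm.X_dvd_vertChart hb
  · rcases hS with ⟨t, ht⟩ | hv
    · exact PlaneGerm.isTransform_ne_zero (fun f hf => PlaneGerm.subst_dirChart_ne_zero t hf) ht
    · exact PlaneGerm.isTransform_ne_zero (fun f hf => PlaneGerm.subst_vertChart_ne_zero hf) hv
  · obtain ⟨e, rfl⟩ := hbd
    have he : e ≠ 0 := right_ne_zero_of_mul hd
    refine ⟨fun t ht => ?_, fun hv => ?_⟩
    · obtain ⟨E, hE⟩ :=
        PlaneGerm.exists_isTransform (PlaneGerm.hasSubst_dirChart t) (PlaneGerm.X_dvd_dirChart t) he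
      exact PlaneGerm.exists_isTransform_mul (PlaneGerm.hasSubst_dirChart t) ht hE
    · obtain ⟨E, hE⟩ :=
        PlaneGerm.exists_isTransform PlaneGerm.hasSubst_vertChart PlaneGerm.X_dvd_vertChart he
      exact PlaneGerm.exists_isTransform_mul PlaneGerm.hasSubst_vertChart hv hE

end Summit.ResolutionOfSingularities.ResolutionOfSingularities.Theorems
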